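import Literature.Combinatorics.SimpleGraph.ReducedDivisorsDhar
import Mathlib.Combinatorics.SimpleGraph.Prod
import Mathlib.Data.Nat.Pairing
import HarnessLib

/-!
# Parking functions on Cartesian products: `f₁ □ f₂ = f₁ + f₂ + 1` is a `G₁ □ G₂`-parking
# function, maximum if `f₁, f₂` are (Benson–Chakrabarty–Tetali 2010, Proposition 5.1)

Source (held, read at the page; statements VERBATIM). B. Benson, D. Chakrabarty, P. Tetali,
*`G`-parking functions, acyclic orientations and spanning trees*, Discrete Math. 310 (2010)
1340–1353 [BensonChakrabartyTetali2010] (held text `paper:arxiv-0801.1114`, chunk p0015), §5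
«Product Graphs and `Q_n`-Parking Functions»: «**Definition 5.1.** Given `G₁ = (V₁, E₁)` and
`G₂ = (V₂, E₂)`, the Cartesian product graph `G₁ □ G₂ = (V, E)` is defined on the vertex set
`V = V₁ × V₂`, using the edge set `E = E′ ∪ E″`, where
`E′ = { {(u₁,v), (u₂,v)} : {u₁,u₂} ∈ E₁ and v ∈ V₂ }`, and
`E″ = { {(u,v₁), (u,v₂)} : {v₁,v₂} ∈ E₂ and u ∈ V₁ }`. It is easy to see from the definition that
the number of vertices in `G₁ □ G₂` is `|V₁| |V₂|`, and that the number of edges is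
`|V(G₂)| |E(G₁)| + |V(G₁)| |E(G₂)|. […] **Proposition 5.1.** Let `f₁ ∈ 𝒫(G₁; q₁)` and
`f₂ ∈ 𝒫(G₂; q₂)`. Then `f₁ □ f₂ ∈ 𝒫(G₁ □ G₂; (q₁,q₂))`, where `f₁ □ f₂(u,v) = f₁(u) + f₂(v) + 1`,
whenever `u ∈ G₁` and `v ∈ G₂`. Further, if `f₁` and `f₂` are maximum parking functions, then
`f₁ □ f₂` is a maximum parking function. […] To show that `f ∈ 𝒫(G)`, once again we make crucial
use of Dhar's marking algorithm; in particular, we will make use of the order in which the vertices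
of `G₁` (and `G₂`) are marked in verifying that `f₁ ∈ 𝒫(G₁)` (and `f₂ ∈ 𝒫(G₂)`, respectively).
Using these in turn, we order the vertices in `G₁ □ G₂`: let `(u′,v′) <_□ (u,v)`, if `u′` is marked
before `u` in `G₁`, or if `u = u′` and `v′` is marked before `v` in `G₂`.» (Parking functions carry
the value `f(q) = −1` at the base vertex, §2.)

## What is formalised (vocabulary: `IsReduced G q D` of `ReducedDivisors` — a `G`-parking function
## relative to `q` is a `q`-reduced divisor with `D(q) = −1`; maximum ones have `deg D = g − 1`
## (`ParkingFunctionsAcyclicOrientations`); Dhar's marking orders are the burning rankings of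
## `ReducedDivisorsDhar.isReduced_iff_exists_burningOrder`; Mathlib's `G □ H`)

* `card_edgeFinset_boxProd` («the number of edges is `|V(G₂)| |E(G₁)| + |V(G₁)| |E(G₂)|`») and
  `genus_boxProd` (`g(G₁ □ G₂) = |V₂| g₁ + |V₁| g₂ + (|V₁| − 1)(|V₂| − 1)`);
* `card_filter_neighborFinset_boxProd` (in the lexicographic product `<_□` of two vertex
  rankings, the earlier neighbours of `(u,v)` are the earlier `G₁`-neighbours of `u` and the
  earlier `G₂`-neighbours of `v`);
* **Proposition 5.1**: **`IsReduced.boxProd`** (`f₁ □ f₂` is a `(q₁,q₂)`-reduced divisor, with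
  `boxProd_apply_base : f₁ □ f₂ (q₁,q₂) = −1`), **`sum_boxProd_eq_genus_sub_one`** (if
  `deg fᵢ = gᵢ − 1` then `deg (f₁ □ f₂) = g(G₁ □ G₂) − 1`) and the bundled `maximum_boxProd`
  (maximum times maximum is maximum).

Theorems only; no `sorry`; no named facts.
-/

open Finset SimpleGraph

namespace Literature.Combinatorics.SimpleGraph.BakerNorine

variable {α β : Type*} [Fintype α] [DecidableEq α] [Fintype β] [DecidableEq β]
variable {G : SimpleGraph α} [DecidableRel G.Adj] {H : SimpleGraph β} [DecidableRel H.Adj]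
variable [DecidableRel (G □ H).Adj]

/-! ### §1 Edges and genus of the Cartesian product -/

section Genus

omit [DecidableEq α] [DecidableEq β] in
variable (G H) in
/-- «The number of edges [of `G₁ □ G₂`] is `|V(G₂)| |E(G₁)| + |V(G₁)| |E(G₂)|`» (by the
handshake lemma and `deg_{G□H}(u,v) = deg u + deg v`).
[cite: BensonChakrabartyTetali2010, Definition 5.1] -/
theorem card_edgeFinset_boxProd :
    #(G □ H).edgeFinset = Fintype.card β * #G.edgeFinset + Fintype.card α * #H.edgeFinset := by
  -- `deg_{G □ H}(u,v) = deg u + deg v`, for whichever `Fintype` instance the neighbour set carries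
  have hdeg : ∀ (y : α × β) (inst : Fintype ((G □ H).neighborSet y)),
      @SimpleGraph.degree _ (G □ H) y inst = G.degree y.1 + H.degree y.2 := fun y inst =>
    degree_boxProd y
  have h : ∑ a, ∑ b, (G.degree a + H.degree b) = 2 * #(G □ H).edgeFinset := by
    rw [← (G □ H).sum_degrees_eq_twice_card_edges, Fintype.sum_prod_type]
    exact Finset.sum_congr rfl fun a _ => Finset.sum_congr rfl fun b _ => (hdeg (a, b) _).symm
  have key : ∑ a, ∑ b, (G.degree a + H.degree b) =
      Fintype.card β * ∑ a, G.degree a + Fintype.card α * ∑ b, H.degree b := by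
    simp only [Finset.sum_add_distrib, Finset.sum_const, Finset.card_univ, smul_eq_mul,
      Finset.mul_sum]
  rw [key, G.sum_degrees_eq_twice_card_edges, H.sum_degrees_eq_twice_card_edges] at h
  have h' : 2 * #(G □ H).edgeFinset =
      2 * (Fintype.card β * #G.edgeFinset + Fintype.card α * #H.edgeFinset) := by
    rw [← h]; ring
  exact Nat.eq_of_mul_eq_mul_left (by norm_num) h'

omit [DecidableEq α] [DecidableEq β] in
variable (G H) in
/-- The genus (cyclomatic number) of a Cartesian product:
`g(G₁ □ G₂) = |V₂| g(G₁) + |V₁| g(G₂) + (|V₁| − 1)(|V₂| − 1)`.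
[cite: BensonChakrabartyTetali2010, Definition 5.1 (edge count) with Proposition 2.3] -/
theorem genus_boxProd :
    genus (G □ H) = Fintype.card β * genus G + Fintype.card α * genus H +
      (Fintype.card α - 1) * (Fintype.card β - 1) := by
  rw [genus_eq, genus_eq, genus_eq, card_edgeFinset_boxProd, Fintype.card_prod]
  push_cast
  ring

end Genus

/-! ### §2 The product order `<_□` of two marking orders -/

section Order

omit [DecidableEq α] [DecidableEq β] [DecidableRel (G □ H).Adj] in
/-- In the lexicographic product ranking `(u,v) ↦ ⟨ρ₁ u, ρ₂ v⟩` («`(u′,v′) <_□ (u,v)` if `u′` is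
marked before `u` in `G₁`, or if `u = u′` and `v′` is marked before `v` in `G₂`»), the earlier
neighbours of `(u,v)` in `G₁ □ G₂` are the `(u′,v)` with `u′` an earlier neighbour of `u` and the
`(u,v′)` with `v′` an earlier neighbour of `v` (stated for whichever `Fintype` instance the
neighbour set of `G₁ □ G₂` carries). [cite: BensonChakrabartyTetali2010, Proposition 5.1 (proof)] -/
theorem card_filter_neighborFinset_boxProd (ρ₁ : α → ℕ) (ρ₂ : β → ℕ) (x : α × β)
    {inst : Fintype ((G □ H).neighborSet x)} :
    #{w ∈ (G □ H).neighborFinset x |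
        Nat.pair (ρ₁ w.1) (ρ₂ w.2) < Nat.pair (ρ₁ x.1) (ρ₂ x.2)} =
      #{a ∈ G.neighborFinset x.1 | ρ₁ a < ρ₁ x.1} + #{b ∈ H.neighborFinset x.2 | ρ₂ b < ρ₂ x.2} := by
  have hl : ∀ a₁ a₂ b : ℕ, Nat.pair a₁ b < Nat.pair a₂ b ↔ a₁ < a₂ := fun a₁ a₂ b => by
    refine ⟨fun h => ?_, Nat.pair_lt_pair_left b⟩
    by_contra hle
    rw [not_lt] at hle
    rcases hle.eq_or_lt with heq | hlt
    · rw [heq] at h; exact lt_irrefl _ h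
    · exact lt_asymm h (Nat.pair_lt_pair_left b hlt)
  have hr : ∀ a b₁ b₂ : ℕ, Nat.pair a b₁ < Nat.pair a b₂ ↔ b₁ < b₂ := fun a b₁ b₂ => by
    refine ⟨fun h => ?_, Nat.pair_lt_pair_right a⟩
    by_contra hle
    rw [not_lt] at hle
    rcases hle.eq_or_lt with heq | hlt
    · rw [heq] at h; exact lt_irrefl _ h
    · exact lt_asymm h (Nat.pair_lt_pair_right a hlt)
  rw [neighborFinset_boxProd, Finset.filter_disjUnion, Finset.card_disjUnion,
    Finset.product_singleton, Finset.singleton_product, Finset.filter_map, Finset.card_map,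
    Finset.filter_map, Finset.card_map]
  congr 1
  · congr 1
    exact Finset.filter_congr fun a _ => by
      simp only [Function.comp_apply, Function.Embedding.coeFn_mk, hl]
  · congr 1
    exact Finset.filter_congr fun b _ => by
      simp only [Function.comp_apply, Function.Embedding.coeFn_mk, hr]

end Order

/-! ### §3 Proposition 5.1 -/

section Product

omit [Fintype α] [DecidableEq α] [Fintype β] [DecidableEq β] in
/-- `f₁ □ f₂ (q₁,q₂) = f₁(q₁) + f₂(q₂) + 1 = −1`: the product of two parking functions has the
base value `−1` at `(q₁,q₂)`. [cite: BensonChakrabartyTetali2010, Proposition 5.1] -/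
theorem boxProd_apply_base {q₁ : α} {q₂ : β} {f₁ : α → ℤ} {f₂ : β → ℤ} (hq₁ : f₁ q₁ = -1)
    (hq₂ : f₂ q₂ = -1) : (fun x : α × β => f₁ x.1 + f₂ x.2 + 1) (q₁, q₂) = -1 := by
  simp only [hq₁, hq₂]; rfl

/-- **Proposition 5.1 (first part).** «Let `f₁ ∈ 𝒫(G₁; q₁)` and `f₂ ∈ 𝒫(G₂; q₂)`. Then
`f₁ □ f₂ ∈ 𝒫(G₁ □ G₂; (q₁,q₂))`, where `f₁ □ f₂(u,v) = f₁(u) + f₂(v) + 1`»: with the tree's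
parking functions (`qᵢ`-reduced divisors with `fᵢ(qᵢ) = −1`), `f₁ □ f₂` is `(q₁,q₂)`-reduced —
proved as in the source through Dhar's marking orders and their product order `<_□`.
[cite: BensonChakrabartyTetali2010, Proposition 5.1] -/
theorem IsReduced.boxProd {q₁ : α} {q₂ : β} {f₁ : α → ℤ} {f₂ : β → ℤ}
    (h₁ : IsReduced G q₁ f₁) (hq₁ : f₁ q₁ = -1) (h₂ : IsReduced H q₂ f₂) (hq₂ : f₂ q₂ = -1) :
    IsReduced (G □ H) (q₁, q₂) (fun x : α × β => f₁ x.1 + f₂ x.2 + 1) := by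
  obtain ⟨h0₁, ρ₁, hρ₁, hb₁, hburn₁⟩ := isReduced_iff_exists_burningOrder.1 h₁
  obtain ⟨h0₂, ρ₂, hρ₂, hb₂, hburn₂⟩ := isReduced_iff_exists_burningOrder.1 h₂
  -- every value of a parking function is `≥ −1`
  have hge₁ : ∀ a, -1 ≤ f₁ a := fun a => by
    by_cases ha : a = q₁
    · rw [ha, hq₁]
    · have := h0₁ a ha; omega
  have hge₂ : ∀ b, -1 ≤ f₂ b := fun b => by
    by_cases hb : b = q₂
    · rw [hb, hq₂]
    · have := h0₂ b hb; omega
  refine isReduced_iff_exists_burningOrder.2 ⟨fun x hx => ?_,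
    fun x => Nat.pair (ρ₁ x.1) (ρ₂ x.2), fun x y hxy => ?_, ?_, fun x hx => ?_⟩
  · -- nonnegative off the base vertex
    by_cases ha : x.1 = q₁
    · have hb : x.2 ≠ q₂ := fun hb => hx (Prod.ext ha hb)
      have := h0₂ x.2 hb; have := hge₁ x.1; omega
    · have := h0₁ x.1 ha; have := hge₂ x.2; omega
  · -- the product ranking is injective
    obtain ⟨h1, h2⟩ := Nat.pair_eq_pair.1 hxy
    exact Prod.ext (hρ₁ h1) (hρ₂ h2)
  · -- the base vertex comes first
    show Nat.pair (ρ₁ q₁) (ρ₂ q₂) = 0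
    rw [hb₁, hb₂]
    rfl
  · -- the burning inequality at `x ≠ (q₁,q₂)`
    beta_reduce
    rw [card_filter_neighborFinset_boxProd ρ₁ ρ₂ x, Nat.cast_add]
    by_cases ha : x.1 = q₁
    · have hb : x.2 ≠ q₂ := fun hb => hx (Prod.ext ha hb)
      have h2 := hburn₂ x.2 hb
      rw [ha, hq₁]
      have h1 : (0 : ℤ) ≤ #{a ∈ G.neighborFinset q₁ | ρ₁ a < ρ₁ q₁} := Nat.cast_nonneg _
      omega
    · have h1 := hburn₁ x.1 ha
      by_cases hb : x.2 = q₂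
      · rw [hb, hq₂]
        have h2 : (0 : ℤ) ≤ #{b ∈ H.neighborFinset q₂ | ρ₂ b < ρ₂ q₂} := Nat.cast_nonneg _
        omega
      · have h2 := hburn₂ x.2 hb
        omega

omit [DecidableEq α] [DecidableEq β] in
variable (G H) in
/-- **Proposition 5.1 (second part).** «Further, if `f₁` and `f₂` are maximum parking functions,
then `f₁ □ f₂` is a maximum parking function»: the degrees add up —
`deg(f₁ □ f₂) = |V₂| deg f₁ + |V₁| deg f₂ + |V₁||V₂| = g(G₁ □ G₂) − 1` when `deg fᵢ = gᵢ − 1`.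
[cite: BensonChakrabartyTetali2010, Proposition 5.1] -/
theorem sum_boxProd_eq_genus_sub_one {f₁ : α → ℤ} {f₂ : β → ℤ}
    (hf₁ : ∑ a, f₁ a = genus G - 1) (hf₂ : ∑ b, f₂ b = genus H - 1) :
    ∑ x : α × β, (f₁ x.1 + f₂ x.2 + 1) = genus (G □ H) - 1 := by
  have e1 : ∑ x : α × β, f₁ x.1 = Fintype.card β * ∑ a, f₁ a := by
    rw [Fintype.sum_prod_type]
    simp only [Finset.sum_const, Finset.card_univ, nsmul_eq_mul]
    rw [Finset.mul_sum]
  have e2 : ∑ x : α × β, f₂ x.2 = Fintype.card α * ∑ b, f₂ b := by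
    rw [Fintype.sum_prod_type]
    simp only [Finset.sum_const, Finset.card_univ, nsmul_eq_mul]
  have e3 : ∑ _x : α × β, (1 : ℤ) = Fintype.card α * Fintype.card β := by
    rw [Finset.sum_const, Finset.card_univ, Fintype.card_prod, nsmul_eq_mul, mul_one, Nat.cast_mul]
  rw [Finset.sum_add_distrib, Finset.sum_add_distrib, e1, e2, e3, hf₁, hf₂, genus_boxProd]
  ring

/-- **Proposition 5.1, both parts together**: the product of two maximum parking functions
(`qᵢ`-reduced, `fᵢ(qᵢ) = −1`, `deg fᵢ = gᵢ − 1`) is a maximum parking function of `G₁ □ G₂`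
relative to `(q₁,q₂)`. [cite: BensonChakrabartyTetali2010, Proposition 5.1] -/
theorem maximum_boxProd {q₁ : α} {q₂ : β} {f₁ : α → ℤ} {f₂ : β → ℤ}
    (h₁ : IsReduced G q₁ f₁ ∧ f₁ q₁ = -1 ∧ ∑ a, f₁ a = genus G - 1)
    (h₂ : IsReduced H q₂ f₂ ∧ f₂ q₂ = -1 ∧ ∑ b, f₂ b = genus H - 1) :
    IsReduced (G □ H) (q₁, q₂) (fun x : α × β => f₁ x.1 + f₂ x.2 + 1) ∧
      (fun x : α × β => f₁ x.1 + f₂ x.2 + 1) (q₁, q₂) = -1 ∧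
      ∑ x : α × β, (f₁ x.1 + f₂ x.2 + 1) = genus (G □ H) - 1 :=
  ⟨h₁.1.boxProd h₁.2.1 h₂.1 h₂.2.1, boxProd_apply_base h₁.2.1 h₂.2.1,
    sum_boxProd_eq_genus_sub_one G H h₁.2.2 h₂.2.2⟩

end Product

end Literature.Combinatorics.SimpleGraph.BakerNorine
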